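import Mathlib.Combinatorics.SimpleGraph.Coloring.Vertex
import Mathlib.Data.Set.Card
import Literature.Computability.Complexity.ApproximateCounting
import Literature.Computability.Complexity.GraphEncodings
import Literature.Computability.Complexity.RunRule
import Literature.Computability.Complexity.PairProjections
import HarnessLib

/-!
# Fully polynomial randomised approximation schemes (FPRAS) and AP-reducibility

Trunk `Literature/Computability/Complexity`, neighbourhood of `ApproximateCounting.lean` (whose
vocabulary `countQuery` / `countEstimate` / `IsApproxCount` / `uniformProb` it reuses). The notions of
Dyer–Goldberg–Greenhill–Jerrum, *The relative complexity of approximate counting problems*,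
Algorithmica 38 (2003) 471–500 (`DyerEtAl2003`), §1 "The setting":

> "A *randomised approximation scheme* (RAS) for a function `f : Σ* → ℕ` is a probabilistic Turing
> machine that takes as input a pair `(x, ε) ∈ Σ* × (0,1)` and produces as output an integer random
> variable `Y` satisfying the condition `Pr(e^{-ε} ≤ Y/f(x) ≤ e^{ε}) ≥ 3/4`. A randomised
> approximation scheme is said to be *fully polynomial* if it runs in time `poly(|x|, ε⁻¹)`. […]
> An *approximation-preserving reduction* from `f` to `g` is a probabilistic oracle TM `M` that
> takes as input a pair `(x, ε) ∈ Σ* × (0,1)`, and satisfies the following three conditions: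
> (i) every oracle call made by `M` is of the form `(w, δ)`, where `w ∈ Σ*` is an instance of `g`,
> and `0 < δ < 1` is an error bound satisfying `δ⁻¹ ≤ poly(|x|, ε⁻¹)`; (ii) the TM `M` meets the
> specification for being a randomised approximation scheme for `f` whenever the oracle meets the
> specification for being a randomised approximation scheme for `g`; and (iii) the run-time of `M`
> is polynomial in `|x|` and `ε⁻¹`. If an approximation-preserving reduction from `f` to `g` exists
> we write `f ≤_AP g`."

and the counting functions of the `#BIS` programme that route `PneNP/BISOrderDimension` inlines
(`downsetCount` = #IDEALS / #DOWNSETS, `downsetCountOfRows d`, `bisCount` = #BIS, `bisCountMaxDeg Δ`).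

## Tree form

* **`HasFPRAS N`** — the *oracle-free shape of `stockmeyerApproxCounting`*: a DETERMINISTIC
  polynomial-time transducer `F ∈ FP` reading its coins `u` from the query
  `⟨x, 1⁰, 1^{kη}, 1^{kδ}, u⟩` (`countQuery x 0 kη kδ u`; Aaronson–Arkhipov's convention for
  randomised machines, "a deterministic algorithm that takes a random string as part of its input"),
  the accuracy `η = 1/kη` and the confidence `δ = 1/kδ` in unary, a polynomial coin budget
  `c(|x| + kη + kδ)`, and the requirement that for all but a fraction `≤ 1/kδ` of the coin strings the
  answer read as a number (`countEstimate`) is within the factor `1 + 1/kη` of `N x`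
  (`IsApproxCount`). This is the FPRAS *with confidence parameter*; the textbook FPRAS with the
  constant `3/4` is `ThreeQuartersFPRAS N` (confidence slot frozen at `kδ = 4`). `HasFPRAS N →
  ThreeQuartersFPRAS N` is immediate (`HasFPRAS.threeQuartersFPRAS`); the converse is the
  median/"powering" trick of Jerrum–Valiant–Vazirani (1986, Lemma 6.1: `O(log δ⁻¹)` independent runs
  and a median vote), quoted by DGGJ ("the failure probability may be made negligible through repeated
  trials [10, Lemma 6.1]"); it is proved in the sequel file on amplification, not here.
  Accuracy `1 + 1/kη` versus DGGJ's `e^{±ε}`: `1 + 1/k ≤ e^{1/k}` and `e^{1/(2k)} ≤ 1 + 1/k`, so the two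
  scales are polynomially related and give the same class of functions admitting an FPRAS.
* **`APReducible N N'`** (`N ≤_AP N'`) — DGGJ's AP-reduction in the tree's transcript model of oracle
  computation (`Oracle.lean`: `OracleAlg`, step function `(input, answers so far) ↦ query | output`;
  `RunRule.lean`: runs `OracleAlg.runRule` under a history-dependent answer rule). The reduction is a
  polynomial-time `M : OracleAlg (List Bool)` (`IsPolyTime`, queries of length `≤ q(|input|)`, so the
  unary tolerance `1ᵏ` of any oracle call is polynomially bounded — DGGJ's clause (i)) run on
  `countQuery x 0 kη kδ u` (instance, accuracy, CONFIDENCE, own coins) for `q(|·|)` rounds; its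
  oracle calls are the canonical counting queries `countQuery y 0 k 1 []` ("of the form `(w, δ)`");
  clause (ii) is rendered as: for all but a fraction `≤ 1/kδ` of the coin strings `u`, EVERY answer
  rule that answers each canonical query `(y, k)` within the factor `1 + 1/k` of `N' y`
  (`IsApproxCountRule N'`, answers may depend on the history) leads `M` to output, within the round
  budget, a number within `1 + 1/kη` of `N x`.
  *Relation to the printed definition.* DGGJ's oracle is a RAS (each call independently correct
  with probability `≥ 3/4`); here the oracle answers are adversarial but always within tolerance, and
  `M` carries a confidence parameter. (a) Every reduction in the present sense is one in DGGJ's sense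
  once each oracle call is repeated `O(log)` times with a median vote (JVV Lemma 6.1) — the direction
  used to DERIVE FPRASes, `HasFPRAS.of_apReducible` in the sequel; (b) a DGGJ reduction whose
  correctness argument is "if all oracle answers are within tolerance then the output is" — in
  particular every coin-free (deterministic given the oracle) reduction, which covers the
  parsimonious and single-query reductions of the route — is a reduction in the present sense
  (`APReducible.intro_of_forall`). Reductions whose own coins are correlated with the slack of the
  oracle answers are the only ones the transcript-uniform clause excludes; DGGJ (§1) "only rarely make
  use of the full generality" of probabilistic Turing reductions. The preorder facts (reflexivity,
  transitivity, `HasFPRAS` closed downwards) are proved in the sequel files.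
* **Counting functions** on code words (`GraphEncodings.lean`: `encodingNatMatrix`,
  `encodingGraph`; undecodable words count `0`, a documented junk value shared with the route):
  `downsetCount` (implication-closed subsets of an `ℕ`-matrix: `M i j ≠ 0`, `i ∈ I ⇒ j ∈ I`),
  `downsetCountOfRows d` (down-sets of the dominance order of the first `d` rows), `bisCount`
  (independent sets of a `2`-colourable graph, else `0`), `bisCountMaxDeg Δ` (the same on graphs of
  maximum degree `≤ Δ`, else `0`). The route's inlined statements are literally
  `¬ HasFPRAS downsetCount`, `¬ HasFPRAS (downsetCountOfRows 3)`, `HasFPRAS (downsetCountOfRows 3) →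
  HasFPRAS bisCount`, … (definitional unfolding, checked by `Iff.rfl` at vendoring time).

What is NOT here (sequel files): the amplification `ThreeQuartersFPRAS N → HasFPRAS N`
(`hasFPRAS_iff_threeQuarters`), the pull-back of an FPRAS along a count-preserving `FP` map and along
an AP-reduction (`HasFPRAS.comp_countPreserving`, `HasFPRAS.of_apReducible`), and the combinatorics
`downsetCount = #antichains`.

## References

* M. Dyer, L. A. Goldberg, C. Greenhill, M. Jerrum, *The relative complexity of approximate counting
  problems*, Algorithmica 38 (2003) 471–500, §1 (RAS, FPRAS, AP-reducibility), §3 (`#BIS`,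
  `#DOWNSETS`, `#1P1NSAT`) [DyerEtAl2003].
* M. R. Jerrum, L. G. Valiant, V. V. Vazirani, *Random generation of combinatorial structures from a
  uniform distribution*, Theoret. Comput. Sci. 43 (1986) 169–188, Lemma 6.1 (powering lemma)
  [JerrumValiantVazirani1986].
* S. Aaronson, A. Arkhipov, *The computational complexity of linear optics*, Theory of Computing 9
  (2013), Def. 2.4 and Thm. 1.1 (randomised machines read a random string; `FBPP`)
  [AaronsonArkhipovToC2013].
* S. Arora, B. Barak, *Computational Complexity: A Modern Approach*, CUP 2009, §3.4 (oracle machines),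
  §17.1.1 (approximate counting) [AroraBarak2009].
-/

namespace Literature.Computability.Complexity

open _root_.Computability

/-! ### FPRAS, with confidence parameter and in the textbook `3/4` form -/

/-- **`HasFPRAS N`: the counting function `N : {0,1}* → ℕ` admits a fully polynomial randomised
approximation scheme**, in the oracle-free shape of `stockmeyerApproxCounting`: there are a
deterministic polynomial-time transducer `F ∈ FP` and a polynomial coin budget `c` such that for every
instance `x` and all `kη, kδ ≥ 1`, for all but a fraction `≤ 1/kδ` of the coin strings
`u ∈ {0,1}^{c(|x| + kη + kδ)}`, the answer of `F` on `⟨x, 1⁰, 1^{kη}, 1^{kδ}, u⟩` read as a number `Y`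
(`countEstimate F x 0 kη kδ u`) satisfies `N x/(1 + 1/kη) ≤ Y ≤ (1 + 1/kη) · N x` (`IsApproxCount`).
DGGJ's FPRAS ("`Pr(e^{-ε} ≤ Y/f(x) ≤ e^{ε}) ≥ 3/4`", time `poly(|x|, ε⁻¹)`) with the confidence
boosted to `1 - δ` in time `poly(|x|, ε⁻¹, δ⁻¹)` (unary `1^{kδ}`; JVV 1986 Lemma 6.1) and the accuracy on
the polynomially equivalent scale `1 + 1/kη`; see `ThreeQuartersFPRAS` for the constant-`3/4` form.
[cite: DyerEtAl2003, §1 (definition of RAS/FPRAS)] -/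
def HasFPRAS (N : List Bool → ℕ) : Prop :=
  ∃ F ∈ FP, ∃ c : Polynomial ℕ, ∀ (x : List Bool) (kη kδ : ℕ), 0 < kη → 0 < kδ →
    uniformProb (c.eval (x.length + kη + kδ))
        {u | ¬ IsApproxCount kη (N x) (countEstimate F x 0 kη kδ u)} ≤ 1 / (kδ : ℝ)

/-- **`ThreeQuartersFPRAS N`: the textbook FPRAS** (success probability the constant `3/4`): some
`F ∈ FP` with a polynomial coin budget `c` answers `⟨x, 1⁰, 1^{kη}, 1⁴, u⟩` (the confidence slot of
`countQuery` frozen at `4`) with a number within the factor `1 + 1/kη` of `N x` for all but a fraction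
`≤ 1/4` of the coin strings `u ∈ {0,1}^{c(|x| + kη)}` — "produces as output an integer random variable
`Y` satisfying `Pr(e^{-ε} ≤ Y/f(x) ≤ e^{ε}) ≥ 3/4`" and "runs in time `poly(|x|, ε⁻¹)`".
[cite: DyerEtAl2003, §1 (definition of RAS/FPRAS)] -/
def ThreeQuartersFPRAS (N : List Bool → ℕ) : Prop :=
  ∃ F ∈ FP, ∃ c : Polynomial ℕ, ∀ (x : List Bool) (kη : ℕ), 0 < kη →
    uniformProb (c.eval (x.length + kη))
        {u | ¬ IsApproxCount kη (N x) (countEstimate F x 0 kη 4 u)} ≤ 1 / 4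

/-- Unfolding lemma for `HasFPRAS`. [folklore] -/
theorem hasFPRAS_iff (N : List Bool → ℕ) :
    HasFPRAS N ↔ ∃ F ∈ FP, ∃ c : Polynomial ℕ, ∀ (x : List Bool) (kη kδ : ℕ), 0 < kη → 0 < kδ →
      uniformProb (c.eval (x.length + kη + kδ))
          {u | ¬ IsApproxCount kη (N x) (countEstimate F x 0 kη kδ u)} ≤ 1 / (kδ : ℝ) :=
  Iff.rfl

/-- `HasFPRAS` depends only on the values of the counting function. [folklore] -/
theorem hasFPRAS_congr {N N' : List Bool → ℕ} (h : ∀ x, N x = N' x) : HasFPRAS N ↔ HasFPRAS N' := by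
  rw [show N = N' from funext h]

/-- **An FPRAS with confidence parameter is a textbook FPRAS**: freeze the confidence slot at
`kδ = 4` (coin budget `c(n + 4)`). The converse is the powering lemma (sequel file).
[cite: JerrumValiantVazirani1986, Lemma 6.1] -/
theorem HasFPRAS.threeQuartersFPRAS {N : List Bool → ℕ} (h : HasFPRAS N) : ThreeQuartersFPRAS N := by
  obtain ⟨F, hF, c, hc⟩ := h
  refine ⟨F, hF, c.comp (Polynomial.X + 4), fun x kη hkη => ?_⟩
  have h4 := hc x kη 4 hkη (by norm_num)
  have heval : (c.comp (Polynomial.X + 4)).eval (x.length + kη) = c.eval (x.length + kη + 4) := by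
    simp [Polynomial.eval_comp]
  rw [heval]
  norm_num at h4 ⊢
  exact h4

/-- **Exactly computable counting functions have an FPRAS**: if `x ↦ ⟨N x⟩₂` is in `FP` then the
transducer "read `x` off the query, output `⟨N x⟩₂`" never errs (`isApproxCount_self`), with no coins.
The non-vacuity witness of `HasFPRAS`. [folklore] -/
theorem HasFPRAS.of_exact {N : List Bool → ℕ} (hN : (fun x => encodeNat (N x)) ∈ FP) : HasFPRAS N := by
  -- the transducer: first field of the first field of `⟨⟨x, ⟨1⁰, ⟨1^{kη}, 1^{kδ}⟩⟩⟩, u⟩` is `x`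
  set F : List Bool → List Bool :=
    (fun x => encodeNat (N x)) ∘ (fun z => (boolUnpair z).1) ∘ (fun z => (boolUnpair z).1) with hFdef
  have hF : F ∈ FP :=
    PolyTimeComputable.comp_holds hN
      (PolyTimeComputable.comp_holds boolUnpairFst_mem_FP boolUnpairFst_mem_FP)
  refine ⟨F, hF, 0, fun x kη kδ _ hkδ => ?_⟩
  have hval : ∀ u, countEstimate F x 0 kη kδ u = N x := by
    intro u
    rw [countEstimate_def, hFdef]
    simp [countQuery, Function.comp_apply, boolUnpair_boolPair, decode_encodeNat]
  have hempty : {u | ¬ IsApproxCount kη (N x) (countEstimate F x 0 kη kδ u)} = ∅ :=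
    Set.eq_empty_iff_forall_notMem.2 fun u hu => hu (by rw [hval]; exact isApproxCount_self kη (N x))
  rw [hempty, uniformProb_empty]
  positivity

/-! ### Approximation-preserving reducibility -/

/-- **`IsApproxCountRule N' R`: the answer rule `R` is an approximate counter for `N'`** — however the
history `E` of earlier answers reads, the canonical counting query `⟨y, 1⁰, 1ᵏ, 1¹, ε⟩`
(`countQuery y 0 k 1 []`, "an oracle call of the form `(w, δ)`", `w = y`, `δ = 1/k`) is answered by a
string reading as a number within the factor `1 + 1/k` of `N' y` (`IsApproxCount`; nothing is asked of
the answers to other strings). Rules are those of `RunRule.lean` (`OracleAlg.Rule`).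
[cite: DyerEtAl2003, §1 (definition of AP-reduction, clauses (i)–(ii))] -/
def IsApproxCountRule (N' : List Bool → ℕ) (R : OracleAlg.Rule) : Prop :=
  ∀ (E : List (List Bool)) (y : List Bool) (k : ℕ), 0 < k →
    IsApproxCount k (N' y) (decodeNat (R E (countQuery y 0 k 1 [])))

/-- **`APReducible N N'` (`N ≤_AP N'`): approximation-preserving reducibility** of
Dyer–Goldberg–Greenhill–Jerrum in the transcript model. There are an oracle transducer
`M : OracleAlg (List Bool)` with polynomial-time step function (`IsPolyTime`), a polynomial `q`
bounding the length of every query it can ask on input `w` by `q(|w|)` (so the unary tolerance of each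
oracle call is polynomially bounded: clause (i)) and serving as its round budget (clause (iii)), and a
polynomial coin budget `c`, such that for every instance `x` and all `kη, kδ ≥ 1`, for all but a
fraction `≤ 1/kδ` of the coin strings `u ∈ {0,1}^{c(|x| + kη + kδ)}` the following holds: under EVERY
answer rule that is an approximate counter for `N'` (`IsApproxCountRule N'`), the run of `M` on
`⟨x, 1⁰, 1^{kη}, 1^{kδ}, u⟩` (`OracleAlg.runRule`, `q(|input|)` rounds) outputs a string reading as a
number within the factor `1 + 1/kη` of `N x` (clause (ii): "`M` meets the specification for being a
randomised approximation scheme for `f` whenever the oracle meets the specification for being a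
randomised approximation scheme for `g`"; see the module docstring, "Relation to the printed
definition", for the confidence parameter, the adversarial-but-valid oracle and history-dependence).
[cite: DyerEtAl2003, §1 (definition of AP-reduction)] -/
def APReducible (N N' : List Bool → ℕ) : Prop :=
  ∃ M : OracleAlg (List Bool), M.IsPolyTime (encodingList Bool) ∧ ∃ q c : Polynomial ℕ,
    (∀ (w : List Bool) (E : List (List Bool)) (z : List Bool),
        M.step w E = Sum.inl z → z.length ≤ q.eval w.length) ∧
    ∀ (x : List Bool) (kη kδ : ℕ), 0 < kη → 0 < kδ →
      uniformProb (c.eval (x.length + kη + kδ))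
        {u | ∃ R : OracleAlg.Rule, IsApproxCountRule N' R ∧
              ¬ ∃ a, M.runRule (countQuery x 0 kη kδ u) R
                      (q.eval (countQuery x 0 kη kδ u).length) [] = some a ∧
                    IsApproxCount kη (N x) (decodeNat a)} ≤ 1 / (kδ : ℝ)

/-- A history-free rule given by an oracle `O` that answers the canonical counting queries within
tolerance is an approximate-counting rule. [folklore] -/
theorem isApproxCountRule_of_oracle {N' : List Bool → ℕ} {O : Oracle}
    (hO : ∀ (y : List Bool) (k : ℕ), 0 < k → IsApproxCount k (N' y) (decodeNat (O (countQuery y 0 k 1 []))))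
    : IsApproxCountRule N' fun _ z => O z :=
  fun _ y k hk => hO y k hk

/-- **The exact rule**: answer `⟨y, …⟩, …⟩` by `⟨N' y⟩₂`, reading the instance `y` off the query as the
first field of its first field (any history, any other fields). [folklore] -/
def exactCountRule (N' : List Bool → ℕ) : OracleAlg.Rule :=
  fun _ z => encodeNat (N' (boolUnpair (boolUnpair z).1).1)

/-- The exact rule is an approximate counter at every accuracy (`isApproxCount_self`): the hypothesis of
clause (ii) is satisfiable. [folklore] -/
theorem isApproxCountRule_exactCountRule (N' : List Bool → ℕ) :
    IsApproxCountRule N' (exactCountRule N') := by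
  intro E y k _
  simp only [exactCountRule, countQuery, boolUnpair_boolPair, decode_encodeNat]
  exact isApproxCount_self k (N' y)

/-- Unfolding lemma for `APReducible`. [folklore] -/
theorem apReducible_iff (N N' : List Bool → ℕ) :
    APReducible N N' ↔
      ∃ M : OracleAlg (List Bool), M.IsPolyTime (encodingList Bool) ∧ ∃ q c : Polynomial ℕ,
        (∀ (w : List Bool) (E : List (List Bool)) (z : List Bool),
            M.step w E = Sum.inl z → z.length ≤ q.eval w.length) ∧
        ∀ (x : List Bool) (kη kδ : ℕ), 0 < kη → 0 < kδ →
          uniformProb (c.eval (x.length + kη + kδ))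
            {u | ∃ R : OracleAlg.Rule, IsApproxCountRule N' R ∧
                  ¬ ∃ a, M.runRule (countQuery x 0 kη kδ u) R
                          (q.eval (countQuery x 0 kη kδ u).length) [] = some a ∧
                        IsApproxCount kη (N x) (decodeNat a)} ≤ 1 / (kδ : ℝ) :=
  Iff.rfl

/-- **Coin-free (and, generally, transcript-uniform) reductions.** To establish `N ≤_AP N'` it
suffices to give a polynomial-time `M` with polynomially bounded queries such that on EVERY input
`⟨x, 1⁰, 1^{kη}, 1^{kδ}, u⟩` and under every approximate-counting rule for `N'` the run outputs a number
within `1 + 1/kη` of `N x`: the failure event is then empty for every coin string (coin budget `0`).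
This is the form in which parsimonious and single-query reductions are AP-reductions.
[cite: DyerEtAl2003, §1 (remarks after the definition: "we shall only rarely make use of the full generality")] -/
theorem APReducible.intro_of_forall {N N' : List Bool → ℕ} (M : OracleAlg (List Bool))
    (hM : M.IsPolyTime (encodingList Bool)) (q : Polynomial ℕ)
    (hq : ∀ (w : List Bool) (E : List (List Bool)) (z : List Bool),
      M.step w E = Sum.inl z → z.length ≤ q.eval w.length)
    (h : ∀ (x : List Bool) (kη kδ : ℕ) (u : List Bool) (R : OracleAlg.Rule), 0 < kη → 0 < kδ →
      IsApproxCountRule N' R →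
        ∃ a, M.runRule (countQuery x 0 kη kδ u) R (q.eval (countQuery x 0 kη kδ u).length) [] = some a ∧
          IsApproxCount kη (N x) (decodeNat a)) :
    APReducible N N' := by
  refine ⟨M, hM, q, 0, hq, fun x kη kδ hkη hkδ => ?_⟩
  have hempty : {u | ∃ R : OracleAlg.Rule, IsApproxCountRule N' R ∧
      ¬ ∃ a, M.runRule (countQuery x 0 kη kδ u) R (q.eval (countQuery x 0 kη kδ u).length) [] = some a ∧
        IsApproxCount kη (N x) (decodeNat a)} = ∅ :=
    Set.eq_empty_iff_forall_notMem.2 fun u ⟨R, hR, hbad⟩ => hbad (h x kη kδ u R hkη hkδ hR)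
  rw [hempty, uniformProb_empty]
  positivity

/-! ### The counting functions of the `#BIS` programme -/

/-- **`#IDEALS` / `#DOWNSETS` on code words**: for the code of an `n × n` matrix `M` over `ℕ`
(`encodingNatMatrix`), the number of subsets `I ⊆ [n]` closed under the implications `i → j` of the
matrix (`M i j ≠ 0`, `i ∈ I ⇒ j ∈ I`) — the down-sets of the preorder generated by the digraph of `M`
(DGGJ's `#DOWNSETS` when the digraph is a partial order, `#1P1NSAT` in general); undecodable words
count `0` (junk value, as in the route). [cite: DyerEtAl2003, §3 (problems #DOWNSETS, #1P1NSAT)] -/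
noncomputable def downsetCount : List Bool → ℕ := fun y =>
  (encodingNatMatrix.decode y).elim 0 fun p =>
    Set.ncard {I : Finset (Fin p.1) | ∀ i ∈ I, ∀ j : Fin p.1, p.2 i j ≠ 0 → j ∈ I}

/-- **Down-sets of a `d`-dimensional dominance order**: for the code of an `n × n` matrix `M` over `ℕ`
whose rows `0, …, d-1` are read as coordinates, the number of subsets `I ⊆ [n]` that are down-sets of
the dominance preorder `j ≼ i :⟺ ∀ k < d, M k j ≤ M k i` (every order of Dushnik–Miller dimension
`≤ d` arises this way); undecodable words count `0`. For `d = 3, 4, 64` these are the counting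
functions of the route items `DimThreeNoFPRAS`, `DimFourBISHard`, `DimSixtyFourBISHard`. [folklore] -/
noncomputable def downsetCountOfRows (d : ℕ) : List Bool → ℕ := fun y =>
  (encodingNatMatrix.decode y).elim 0 fun p =>
    Set.ncard {I : Finset (Fin p.1) |
      ∀ i ∈ I, ∀ j : Fin p.1, (∀ k : Fin p.1, k.val < d → p.2 k j ≤ p.2 k i) → j ∈ I}

/-- **`#BIS` on code words**: for the code of a finite simple graph `G` (`encodingGraph`), the number of
independent sets of `G` if `G` is `2`-colourable (bipartite), and `0` otherwise; undecodable words count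
`0`. [cite: DyerEtAl2003, §3 (problem #BIS)] -/
noncomputable def bisCount : List Bool → ℕ := fun y =>
  (encodingGraph.decode y).elim 0 fun G =>
    Set.ncard {S : Finset (Fin G.1) | G.2.Colorable 2 ∧ ∀ a ∈ S, ∀ b ∈ S, ¬ G.2.Adj a b}

/-- **`#BIS` restricted to maximum degree `≤ Δ`** on code words: the number of independent sets of the
decoded graph if it is `2`-colourable and every vertex has at most `Δ` neighbours, `0` otherwise (and on
undecodable words). The source problem of the calibration item `DimSixtyFourBISHard` (`Δ = 6`).
[folklore] -/
noncomputable def bisCountMaxDeg (Δ : ℕ) : List Bool → ℕ := fun y =>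
  (encodingGraph.decode y).elim 0 fun G =>
    Set.ncard {S : Finset (Fin G.1) |
      G.2.Colorable 2 ∧ (∀ v : Fin G.1, Set.ncard {w : Fin G.1 | G.2.Adj v w} ≤ Δ) ∧
        ∀ a ∈ S, ∀ b ∈ S, ¬ G.2.Adj a b}

/-- `downsetCount` on a code word counts the implication-closed subsets. [folklore] -/
theorem downsetCount_encode (p : Σ n, Fin n → Fin n → ℕ) :
    downsetCount (encodingNatMatrix.encode p) =
      Set.ncard {I : Finset (Fin p.1) | ∀ i ∈ I, ∀ j : Fin p.1, p.2 i j ≠ 0 → j ∈ I} := by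
  simp only [downsetCount, encodingNatMatrix.decode_encode, Option.elim]

/-- `downsetCountOfRows d` on a code word counts the down-sets of the dominance preorder of the first
`d` rows. [folklore] -/
theorem downsetCountOfRows_encode (d : ℕ) (p : Σ n, Fin n → Fin n → ℕ) :
    downsetCountOfRows d (encodingNatMatrix.encode p) =
      Set.ncard {I : Finset (Fin p.1) |
        ∀ i ∈ I, ∀ j : Fin p.1, (∀ k : Fin p.1, k.val < d → p.2 k j ≤ p.2 k i) → j ∈ I} := by
  simp only [downsetCountOfRows, encodingNatMatrix.decode_encode, Option.elim]

/-- `bisCount` on a code word. [folklore] -/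
theorem bisCount_encode (G : Σ n, SimpleGraph (Fin n)) :
    bisCount (encodingGraph.encode G) =
      Set.ncard {S : Finset (Fin G.1) | G.2.Colorable 2 ∧ ∀ a ∈ S, ∀ b ∈ S, ¬ G.2.Adj a b} := by
  simp only [bisCount, encodingGraph.decode_encode, Option.elim]

/-- `bisCountMaxDeg Δ` on a code word. [folklore] -/
theorem bisCountMaxDeg_encode (Δ : ℕ) (G : Σ n, SimpleGraph (Fin n)) :
    bisCountMaxDeg Δ (encodingGraph.encode G) =
      Set.ncard {S : Finset (Fin G.1) |
        G.2.Colorable 2 ∧ (∀ v : Fin G.1, Set.ncard {w : Fin G.1 | G.2.Adj v w} ≤ Δ) ∧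
          ∀ a ∈ S, ∀ b ∈ S, ¬ G.2.Adj a b} := by
  simp only [bisCountMaxDeg, encodingGraph.decode_encode, Option.elim]

open scoped Classical in
/-- On a bipartite code word `bisCount` is the number of independent sets, as a `Finset` cardinality
(the finite form provers compute with; classical decidability). [folklore] -/
theorem bisCount_encode_of_colorable {n : ℕ} {G : SimpleGraph (Fin n)} (hG : G.Colorable 2) :
    bisCount (encodingGraph.encode ⟨n, G⟩) =
      (Finset.univ.filter fun S : Finset (Fin n) => ∀ a ∈ S, ∀ b ∈ S, ¬ G.Adj a b).card := by
  rw [bisCount_encode]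
  have hset : {S : Finset (Fin n) | G.Colorable 2 ∧ ∀ a ∈ S, ∀ b ∈ S, ¬ G.Adj a b} =
      ↑(Finset.univ.filter fun S : Finset (Fin n) => ∀ a ∈ S, ∀ b ∈ S, ¬ G.Adj a b) := by
    ext S
    simp [hG]
  simp only [hset, Set.ncard_coe_finset]

/-- On a non-bipartite code word `bisCount` vanishes. [folklore] -/
theorem bisCount_encode_of_not_colorable {n : ℕ} {G : SimpleGraph (Fin n)} (hG : ¬ G.Colorable 2) :
    bisCount (encodingGraph.encode ⟨n, G⟩) = 0 := by
  rw [bisCount_encode]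
  simp [hG]

open scoped Classical in
/-- `downsetCount` as a `Finset` cardinality (classical decidability). [folklore] -/
theorem downsetCount_encode_eq_card (p : Σ n, Fin n → Fin n → ℕ) :
    downsetCount (encodingNatMatrix.encode p) =
      (Finset.univ.filter fun I : Finset (Fin p.1) => ∀ i ∈ I, ∀ j : Fin p.1, p.2 i j ≠ 0 → j ∈ I).card := by
  rw [downsetCount_encode]
  have hset : {I : Finset (Fin p.1) | ∀ i ∈ I, ∀ j : Fin p.1, p.2 i j ≠ 0 → j ∈ I} =
      ↑(Finset.univ.filter fun I : Finset (Fin p.1) => ∀ i ∈ I, ∀ j : Fin p.1, p.2 i j ≠ 0 → j ∈ I) := by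
    ext I
    simp
  simp only [hset, Set.ncard_coe_finset]

/-- The empty set and the whole ground set are implication-closed, so a decodable instance has
`downsetCount ≥ 1`; in particular `downsetCount` of a code word is positive. [folklore] -/
theorem downsetCount_encode_pos (p : Σ n, Fin n → Fin n → ℕ) :
    0 < downsetCount (encodingNatMatrix.encode p) := by
  classical
  rw [downsetCount_encode_eq_card, Finset.card_pos]
  exact ⟨∅, by simp⟩

end Literature.Computability.Complexity
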